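import Mathlib
import Summits.ResolutionOfSingularities.ResolutionOfSingularities.Theorems.RadicialJungCleanModelsPthPowerDescent
import Literature.AlgebraicGeometry.Resolution.RegularHomReduced
import Literature.AlgebraicGeometry.Resolution.OrderAlongFormalBranch
import Literature.AlgebraicGeometry.Resolution.ExcellentRings
import HarnessLib

/-!
# Route `RadicialJung`, crux `CleanModels` (stmt-ResolutionOfSingularities-15917), line `Sketch` rev 35, stub 6 `stub_cleanProp44` (X44c),
# `τ = 1` residual, (B5″) leaf descent: `p`-TH POWERS DESCEND FROM A MINIMAL FORMAL BRANCH TO THE ALGEBRAIC BRANCH BELOW IT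

Seat decomp-res-hand-2 g14 (structural hand).  The ONE plumbing brick «branch descent» left open by hand-2 g13's (B5″) kernel path
(memo `Cruxes/CleanModels/Lines/Sketch-memo-hand2-g13-stubs-5-7.md` §0 step 4 / §4 (a), route A): for a local G-ring `(R, 𝔪)` of
characteristic `p`, a prime `𝔓` of the completion `R^` which is a MINIMAL prime over `𝔮 R^`, `𝔮 = 𝔓 ∩ R` (e.g. the formal axis of a
straightened births chain over the algebraic `Σ_μ`-curve below it, ✓ `births_axis_leaf`), and `t, w ∈ R`, `ĝ ∈ R^` with
`t + w ĝ^p ∈ 𝔓` (the formal leaf), there are `a, b ∈ R`, `b ∉ 𝔮`, with `t b^p + w a^p ∈ 𝔮` — i.e. `−t/w` is a `p`-th power in `κ(𝔮)`: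
the leaf class has an ALGEBRAIC representative through the generic point of the axis.  Mechanism: `R_𝔮 → (R^)_𝔓` is flat local with
closed fibre a local ring of the formal fibre `κ(𝔮) ⊗_R R^`, which is geometrically regular (G-ring); minimality of `𝔓` makes that closed
fibre a FIELD, so `κ(𝔓) = (R^)_𝔓 / 𝔮 (R^)_𝔓` is a localization of the formal fibre, and `κ(𝔓) ⊗_{κ(𝔮)} κ(𝔮)[T]/(T^p − y)` is reduced
for `y ∉ κ(𝔮)^p`; the fibre half ✓ `forall_pow_ne_of_isReduced_tensor_adjoinRoot` (hand-2 g13) forbids `p`-th roots of `y` in `κ(𝔓)`.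

* `forall_pow_ne_localization_of_isGeometricallyRegular` (+ affine form `forall_add_mul_pow_ne_localization_of_isGeometricallyRegular`)
  — field level: `K` of characteristic `p`, `F` a geometrically regular `K`-algebra, `q` a prime of `F`: an element of `K ∖ K^p` is not
  a `p`-th power in `F_q`.
* `map_under_eq_maximalIdeal_of_mem_minimalPrimes` — if `𝔓` is minimal over `𝔮 S` (`𝔮 = 𝔓 ∩ R`) and `S_𝔓 / 𝔮 S_𝔓` is a domain, then
  `𝔮 S_𝔓 = 𝔓 S_𝔓`.
* `under_comap_includeRight_fiber`, `exists_add_mul_pow_mem_of_mem_comap_fiber` — the descent, stated at a prime of the formal fibre ring.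
* `exists_add_mul_pow_mem_under_of_mem_minimalPrimes` — **the brick**, stated at a prime `𝔓` of `R^` minimal over `(𝔓 ∩ R) R^`;
  `exists_add_mul_pow_mem_maximalIdeal_localization_of_mem_minimalPrimes` — the same in the currency of ✓ `births_axis_leaf`
  (`t + w g^p ∈ 𝔮 R_𝔮` for some `g ∈ R_𝔮`).

Honest framing: OURS, folklore commutative algebra (Matsumura, *Commutative Ring Theory*, §32; EGA IV₂ 7.8.3); nothing here proves (B5″),
the hypotheses of ✓ `cleanProp44_of_tauOneResidual`, X44c, any case of `CleanModels`, or resolution of singularities in characteristic `p`.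
-/

set_option linter.dupNamespace false -- mandated namespace of this single-conjunct summit

noncomputable section

open IsLocalRing TensorProduct Polynomial
open Literature.AlgebraicGeometry.Resolution

namespace Summit.ResolutionOfSingularities.ResolutionOfSingularities.Theorems.RadicialJung.CleanModels

universe u

/-! ## §1 Field level: localizations of geometrically regular algebras acquire no new `p`-th roots of scalars -/

section Field

variable {K : Type u} [Field K] {F : Type u} [CommRing F] [Algebra K F]

/-- **Localizations of a geometrically regular `K`-algebra contain no `p`-th roots of elements of `K ∖ K^p`.**  `K` a field of
characteristic `p`, `F` a geometrically regular `K`-algebra (✓ `Literature.….IsGeometricallyRegular`: `k' ⊗_K F` regular for every finite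
extension `k'/K`), `q` a prime of `F`, `y ∈ K` not a `p`-th power in `K`.  Then `y` is not a `p`-th power in `F_q`: with
`k' = K[T]/(T^p − y)` (a field), `k' ⊗_K F_q` is a localization of the regular, hence reduced, ring `k' ⊗_K F`, so `F_q ⊗_K k'` is reduced
and ✓ `forall_pow_ne_of_isReduced_tensor_adjoinRoot` applies. [cite: Matsumura1987, §32 p. 255] -/
theorem forall_pow_ne_localization_of_isGeometricallyRegular (p : ℕ) [hp : Fact p.Prime] [CharP K p]
    (hF : IsGeometricallyRegular K F) (q : Ideal F) [q.IsPrime] {y : K} (hy : ∀ z : K, z ^ p ≠ y)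
    (c : Localization.AtPrime q) : c ^ p ≠ algebraMap K (Localization.AtPrime q) y := by
  -- `k' = K[T]/(T^p − y)` is a field, finite over `K`
  haveI : Fact (Irreducible (X ^ p - C y : K[X])) := ⟨(X_pow_sub_C_irreducible_iff_of_prime hp.out).2 hy⟩
  haveI : Module.Finite K (AdjoinRoot (X ^ p - C y : K[X])) := (monic_X_pow_sub_C y hp.out.ne_zero).finite_adjoinRoot
  -- `k' ⊗_K F` is regular, hence reduced
  haveI : IsRegularRing (AdjoinRoot (X ^ p - C y : K[X]) ⊗[K] F) := hF _ inferInstance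
  haveI : IsReduced (AdjoinRoot (X ^ p - C y : K[X]) ⊗[K] F) := by
    have h := IsRegularRing.isReduced' (AdjoinRoot (X ^ p - C y : K[X]) ⊗[K] F)
    convert h using 0
  -- `k' ⊗_K F_q` is the localization of `k' ⊗_K F` at (the image of) `F ∖ q`
  letI : Algebra (AdjoinRoot (X ^ p - C y : K[X]) ⊗[K] F) (AdjoinRoot (X ^ p - C y : K[X]) ⊗[K] Localization.AtPrime q) :=
    (Algebra.TensorProduct.map (AlgHom.id K (AdjoinRoot (X ^ p - C y : K[X])))
      (IsScalarTower.toAlgHom K F (Localization.AtPrime q))).toAlgebra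
  haveI : IsScalarTower (AdjoinRoot (X ^ p - C y : K[X])) (AdjoinRoot (X ^ p - C y : K[X]) ⊗[K] F)
      (AdjoinRoot (X ^ p - C y : K[X]) ⊗[K] Localization.AtPrime q) :=
    IsScalarTower.of_algebraMap_eq fun x => by
      simp [RingHom.algebraMap_toAlgebra, Algebra.TensorProduct.algebraMap_apply]
  haveI := IsLocalization.tensorProduct_tensorProduct_right K (AdjoinRoot (X ^ p - C y : K[X])) q.primeCompl
    (Localization.AtPrime q) (by ext; simp [RingHom.algebraMap_toAlgebra])
  haveI : IsReduced (AdjoinRoot (X ^ p - C y : K[X]) ⊗[K] Localization.AtPrime q) :=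
    isReduced_localizationPreserves
      (q.primeCompl.map (Algebra.TensorProduct.includeRight (R := K) (A := AdjoinRoot (X ^ p - C y : K[X])))) _
      inferInstance
  have hred : IsReduced (Localization.AtPrime q ⊗[K] AdjoinRoot (X ^ p - C y : K[X])) :=
    isReduced_of_injective (Algebra.TensorProduct.comm K (Localization.AtPrime q) (AdjoinRoot (X ^ p - C y : K[X]))).toRingHom
      (Algebra.TensorProduct.comm K _ _).injective
  exact forall_pow_ne_of_isReduced_tensor_adjoinRoot p y hred c

/-- Affine form of the previous theorem: for `a, b ∈ K`, `b ≠ 0`, with `a + b z^p ≠ 0` for all `z ∈ K`, also `a + b c^p ≠ 0` for all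
`c ∈ F_q`. [cite: Matsumura1987, §32 p. 255] -/
theorem forall_add_mul_pow_ne_localization_of_isGeometricallyRegular (p : ℕ) [Fact p.Prime] [CharP K p]
    (hF : IsGeometricallyRegular K F) (q : Ideal F) [q.IsPrime] {a b : K} (hb : b ≠ 0)
    (hy : ∀ z : K, a + b * z ^ p ≠ 0) (c : Localization.AtPrime q) :
    algebraMap K (Localization.AtPrime q) a + algebraMap K (Localization.AtPrime q) b * c ^ p ≠ 0 := by
  intro h0
  have hy' : ∀ z : K, z ^ p ≠ -(a * b⁻¹) := by
    intro z hz
    apply hy z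
    rw [hz, mul_neg, ← mul_assoc, mul_comm b a, mul_assoc, mul_inv_cancel₀ hb, mul_one, add_neg_cancel]
  refine forall_pow_ne_localization_of_isGeometricallyRegular p hF q hy' c ?_
  have hbb : algebraMap K (Localization.AtPrime q) b * algebraMap K (Localization.AtPrime q) b⁻¹ = 1 := by
    rw [← map_mul, mul_inv_cancel₀ hb, map_one]
  rw [map_neg, map_mul]
  linear_combination (algebraMap K (Localization.AtPrime q) b⁻¹) * h0 - c ^ p * hbb

end Field

/-! ## §2 Minimal primes over an extended prime: the closed fibre of `R_𝔮 → S_𝔓` is a field -/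

section Minimal

variable {R S : Type u} [CommRing R] [CommRing S] [Algebra R S]

/-- **If `𝔓` is a minimal prime over `𝔮 S`, `𝔮 = 𝔓 ∩ R`, and `S_𝔓 / 𝔮 S_𝔓` is a domain, then `𝔮 S_𝔓 = 𝔓 S_𝔓`** (the maximal ideal
of `S_𝔓`): `𝔮 S_𝔓` is then a prime of `S_𝔓` whose contraction to `S` lies between `𝔮 S` and `𝔓`. [folklore] -/
theorem map_under_eq_maximalIdeal_of_mem_minimalPrimes (𝔓 : Ideal S) [𝔓.IsPrime]
    (hmin : 𝔓 ∈ ((𝔓.under R).map (algebraMap R S)).minimalPrimes)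
    [hdom : IsDomain (Localization.AtPrime 𝔓 ⧸ (𝔓.under R).map (algebraMap R (Localization.AtPrime 𝔓)))] :
    (𝔓.under R).map (algebraMap R (Localization.AtPrime 𝔓)) = maximalIdeal (Localization.AtPrime 𝔓) := by
  set B := Localization.AtPrime 𝔓
  set I := (𝔓.under R).map (algebraMap R B) with hIdef
  have hI : I.IsPrime := (Ideal.Quotient.isDomain_iff_prime I).mp hdom
  have hIS : I = ((𝔓.under R).map (algebraMap R S)).map (algebraMap S B) := by
    rw [Ideal.map_map, ← IsScalarTower.algebraMap_eq]
  -- `J = I ∩ S` is a prime with `𝔮 S ⊆ J ⊆ 𝔓`, hence `J = 𝔓`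
  have hJ : (𝔓.under R).map (algebraMap R S) ≤ I.comap (algebraMap S B) := by
    rw [← Ideal.map_le_iff_le_comap, ← hIS]
  have hJP : I.comap (algebraMap S B) ≤ 𝔓 := fun x hx => by
    by_contra hxP
    exact hI.ne_top (Ideal.eq_top_of_isUnit_mem _ hx (IsLocalization.map_units B (⟨x, hxP⟩ : 𝔓.primeCompl)))
  haveI : (I.comap (algebraMap S B)).IsPrime := Ideal.IsPrime.comap _
  have hPJ : 𝔓 ≤ I.comap (algebraMap S B) := hmin.2 ⟨inferInstance, hJ⟩ hJP
  have hJeq : I.comap (algebraMap S B) = 𝔓 := le_antisymm hJP hPJ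
  calc I = (I.comap (algebraMap S B)).map (algebraMap S B) := (IsLocalization.map_under 𝔓.primeCompl B I).symm
    _ = maximalIdeal B := by rw [hJeq, Localization.AtPrime.map_eq_maximalIdeal]

end Minimal

/-! ## §3 The descent at a prime of the formal fibre ring -/

section FormalFibre

variable {R : Type u} [CommRing R] [IsLocalRing R]

/-- The prime `q ∩ R^` of `R^` below a prime `q` of the formal fibre ring `κ(𝔮) ⊗_R R^` contracts to `𝔮`. [folklore] -/
theorem under_comap_includeRight_fiber (𝔮 : Ideal R) [𝔮.IsPrime] (q : Ideal (𝔮.Fiber (AdicCompletion (maximalIdeal R) R))) [q.IsPrime] :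
    (q.comap (Algebra.TensorProduct.includeRight : (AdicCompletion (maximalIdeal R) R) →ₐ[R] 𝔮.Fiber (AdicCompletion (maximalIdeal R) R))).under R = 𝔮 := by
  ext x
  rw [Ideal.mem_comap, Ideal.mem_comap, AlgHom.commutes, ← Ideal.mem_comap]
  change x ∈ q.under R ↔ x ∈ 𝔮
  rw [← Ideal.LiesOver.over (p := 𝔮) (P := q)]

/-- **Leaf descent at a prime of the formal fibre** (the brick, with the formal prime presented as `q ∩ R^` for a prime `q` of the
formal fibre ring `κ(𝔮) ⊗_R R^` — every prime of `R^` over `𝔮` is of this form, Mathlib's `PrimeSpectrum.primesOverOrderIsoFiber`).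
`R` a local G-ring of characteristic `p`, `𝔮` a prime of `R`, `𝔓 = q ∩ R^` minimal over `𝔮 R^`, `t, w ∈ R`, `ĝ ∈ R^` with
`t + w ĝ^p ∈ 𝔓`: there are `a, b ∈ R`, `b ∉ 𝔮`, with `t b^p + w a^p ∈ 𝔮`. [cite: Matsumura1987, §32 p. 256] -/
theorem exists_add_mul_pow_mem_of_mem_comap_fiber (hG : IsGRing R) (p : ℕ) [hp : Fact p.Prime] [CharP R p]
    (𝔮 : Ideal R) [𝔮.IsPrime] (q : Ideal (𝔮.Fiber (AdicCompletion (maximalIdeal R) R))) [q.IsPrime]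
    (hmin : q.comap (Algebra.TensorProduct.includeRight : (AdicCompletion (maximalIdeal R) R) →ₐ[R] 𝔮.Fiber (AdicCompletion (maximalIdeal R) R)) ∈ (𝔮.map (algebraMap R (AdicCompletion (maximalIdeal R) R))).minimalPrimes)
    {t w : R} {ĝ : (AdicCompletion (maximalIdeal R) R)}
    (h : algebraMap R (AdicCompletion (maximalIdeal R) R) t + algebraMap R (AdicCompletion (maximalIdeal R) R) w * ĝ ^ p ∈
      q.comap (Algebra.TensorProduct.includeRight : (AdicCompletion (maximalIdeal R) R) →ₐ[R] 𝔮.Fiber (AdicCompletion (maximalIdeal R) R))) :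
    ∃ a b : R, b ∉ 𝔮 ∧ t * b ^ p + w * a ^ p ∈ 𝔮 := by
  haveI : IsNoetherianRing R := hG.1
  set r : Ideal (AdicCompletion (maximalIdeal R) R) := q.comap (Algebra.TensorProduct.includeRight : (AdicCompletion (maximalIdeal R) R) →ₐ[R] 𝔮.Fiber (AdicCompletion (maximalIdeal R) R)) with hr
  have hru : r.under R = 𝔮 := under_comap_includeRight_fiber 𝔮 q
  -- the trivial case `w ∈ 𝔮`: then `t ∈ 𝔮`
  by_cases hw : w ∈ 𝔮
  · refine ⟨0, 1, fun h1 => Ideal.IsPrime.ne_top' (Ideal.eq_top_of_isUnit_mem _ h1 isUnit_one), ?_⟩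
    have hwr : algebraMap R (AdicCompletion (maximalIdeal R) R) w * ĝ ^ p ∈ r := by
      refine Ideal.mul_mem_right _ _ ?_
      rw [← Ideal.mem_comap]
      change w ∈ r.under R
      rwa [hru]
    have ht : t ∈ 𝔮 := by
      rw [← hru]
      change algebraMap R (AdicCompletion (maximalIdeal R) R) t ∈ r
      have h2 := Ideal.sub_mem _ h hwr
      rwa [add_sub_cancel_right] at h2
    simpa [zero_pow hp.out.ne_zero] using ht
  -- the formal fibre `F = κ(𝔮) ⊗_R R^` is geometrically regular over `K = κ(𝔮)`
  have hRH : IsRegularHom R (AdicCompletion (maximalIdeal R) R) := hG.isRegularHom_adicCompletion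
  have hgeo : IsGeometricallyRegular 𝔮.ResidueField (𝔮.Fiber (AdicCompletion (maximalIdeal R) R)) := hRH.2 𝔮
  -- `B = (R^)_𝔓`: the closed fibre `B ⧸ 𝔮 B` of `R_𝔮 → B` is a regular local ring, hence a domain, and `≃ L = F_q`
  haveI : IsNoetherianRing (AdicCompletion (maximalIdeal R) R) := isNoetherianRing_adicCompletion_maximalIdeal R
  have hF : IsRegularRing ((r.under R).Fiber (AdicCompletion (maximalIdeal R) R)) := hRH.isRegularRing_fiber (r.under R)
  haveI := isRegularLocalRing_quotient_of_isRegularRing_fiber (A := R) (B := (AdicCompletion (maximalIdeal R) R)) r hF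
  haveI : IsDomain (Localization.AtPrime r ⧸ (r.under R).map (algebraMap R (Localization.AtPrime r))) :=
    isDomain_of_isRegularLocalRing _
  let e : Localization.AtPrime q ≃ₐ[R]
      Localization.AtPrime r ⧸ (𝔮.map (algebraMap R (AdicCompletion (maximalIdeal R) R))).map (algebraMap (AdicCompletion (maximalIdeal R) R) (Localization.AtPrime r)) :=
    Ideal.Fiber.algEquivAux₂ 𝔮 q
  have hI : (𝔮.map (algebraMap R (AdicCompletion (maximalIdeal R) R))).map (algebraMap (AdicCompletion (maximalIdeal R) R) (Localization.AtPrime r)) =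
      (r.under R).map (algebraMap R (Localization.AtPrime r)) := by
    rw [hru, Ideal.map_map, ← IsScalarTower.algebraMap_eq]
  have hmin' : r ∈ ((r.under R).map (algebraMap R (AdicCompletion (maximalIdeal R) R))).minimalPrimes := by rw [hru]; exact hmin
  have hmax : (r.under R).map (algebraMap R (Localization.AtPrime r)) = maximalIdeal (Localization.AtPrime r) :=
    map_under_eq_maximalIdeal_of_mem_minimalPrimes r hmin'
  -- the leaf vanishes in `B ⧸ 𝔮 B`
  have hmemB : algebraMap (AdicCompletion (maximalIdeal R) R) (Localization.AtPrime r) (algebraMap R (AdicCompletion (maximalIdeal R) R) t + algebraMap R (AdicCompletion (maximalIdeal R) R) w * ĝ ^ p) ∈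
      (𝔮.map (algebraMap R (AdicCompletion (maximalIdeal R) R))).map (algebraMap (AdicCompletion (maximalIdeal R) R) (Localization.AtPrime r)) := by
    rw [hI, hmax, ← Localization.AtPrime.map_eq_maximalIdeal]
    exact Ideal.mem_map_of_mem _ h
  -- transport to `L = F_q` (a `K`-algebra) along `ψ : R^ → B → B ⧸ 𝔮 B ≃ L`
  let ψ : (AdicCompletion (maximalIdeal R) R) →ₐ[R] Localization.AtPrime q :=
    e.symm.toAlgHom.comp
      ((Ideal.Quotient.mkₐ R ((𝔮.map (algebraMap R (AdicCompletion (maximalIdeal R) R))).map (algebraMap (AdicCompletion (maximalIdeal R) R) (Localization.AtPrime r)))).comp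
        (IsScalarTower.toAlgHom R (AdicCompletion (maximalIdeal R) R) (Localization.AtPrime r)))
  have hψ0 : ψ (algebraMap R (AdicCompletion (maximalIdeal R) R) t + algebraMap R (AdicCompletion (maximalIdeal R) R) w * ĝ ^ p) = 0 := by
    change e.symm (Ideal.Quotient.mk _
      (algebraMap (AdicCompletion (maximalIdeal R) R) (Localization.AtPrime r) (algebraMap R (AdicCompletion (maximalIdeal R) R) t + algebraMap R (AdicCompletion (maximalIdeal R) R) w * ĝ ^ p))) = 0
    rw [Ideal.Quotient.eq_zero_iff_mem.mpr hmemB, map_zero]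
  have hcL : algebraMap R (Localization.AtPrime q) t + algebraMap R (Localization.AtPrime q) w * (ψ ĝ) ^ p = 0 := by
    rw [map_add, map_mul, map_pow, AlgHom.commutes, AlgHom.commutes] at hψ0
    exact hψ0
  -- over `K = κ(𝔮)`: by §1, `t + w z^p = 0` for some `z ∈ K`
  haveI : CharP 𝔮.ResidueField p := (CharP.charP_iff_prime_eq_zero hp.out).2 (by
    rw [← map_natCast (algebraMap R 𝔮.ResidueField), CharP.cast_eq_zero, map_zero])
  have hwK : algebraMap R 𝔮.ResidueField w ≠ 0 := by
    rwa [Ne, Ideal.algebraMap_residueField_eq_zero]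
  rw [IsScalarTower.algebraMap_apply R 𝔮.ResidueField (Localization.AtPrime q) t,
    IsScalarTower.algebraMap_apply R 𝔮.ResidueField (Localization.AtPrime q) w] at hcL
  obtain ⟨z, hz⟩ : ∃ z : 𝔮.ResidueField,
      algebraMap R 𝔮.ResidueField t + algebraMap R 𝔮.ResidueField w * z ^ p = 0 := by
    by_contra hne
    push Not at hne
    exact forall_add_mul_pow_ne_localization_of_isGeometricallyRegular p hgeo q hwK hne _ hcL
  -- write `z = a/b` with `a, b ∈ R`, `b ∉ 𝔮`
  obtain ⟨a', b', hb', rfl⟩ := IsFractionRing.div_surjective (A := R ⧸ 𝔮) z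
  obtain ⟨a, rfl⟩ := Ideal.Quotient.mk_surjective a'
  obtain ⟨b, rfl⟩ := Ideal.Quotient.mk_surjective b'
  have hb0 : Ideal.Quotient.mk 𝔮 b ≠ 0 := nonZeroDivisors.ne_zero hb'
  have hb : b ∉ 𝔮 := fun hb => hb0 (Ideal.Quotient.eq_zero_iff_mem.mpr hb)
  have hbK : algebraMap R 𝔮.ResidueField b ≠ 0 := by rwa [Ne, Ideal.algebraMap_residueField_eq_zero]
  refine ⟨a, b, hb, ?_⟩
  rw [← Ideal.algebraMap_residueField_eq_zero (I := 𝔮), map_add, map_mul, map_mul, map_pow, map_pow]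
  have ha : algebraMap (R ⧸ 𝔮) 𝔮.ResidueField (Ideal.Quotient.mk 𝔮 a) = algebraMap R 𝔮.ResidueField a := by
    rw [← Ideal.Quotient.algebraMap_eq, ← IsScalarTower.algebraMap_apply]
  have hbb : algebraMap (R ⧸ 𝔮) 𝔮.ResidueField (Ideal.Quotient.mk 𝔮 b) = algebraMap R 𝔮.ResidueField b := by
    rw [← Ideal.Quotient.algebraMap_eq, ← IsScalarTower.algebraMap_apply]
  rw [ha, hbb, div_pow] at hz
  have h3 : algebraMap R 𝔮.ResidueField t * algebraMap R 𝔮.ResidueField b ^ p +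
      algebraMap R 𝔮.ResidueField w * algebraMap R 𝔮.ResidueField a ^ p =
      (algebraMap R 𝔮.ResidueField t + algebraMap R 𝔮.ResidueField w *
        (algebraMap R 𝔮.ResidueField a ^ p / algebraMap R 𝔮.ResidueField b ^ p)) * algebraMap R 𝔮.ResidueField b ^ p := by
    rw [add_mul, mul_assoc, div_mul_cancel₀ _ (pow_ne_zero p hbK)]
  rw [h3, hz, zero_mul]

end FormalFibre

/-! ## §4 The brick: leaf descent from a minimal formal branch -/

section Brick

variable {R : Type u} [CommRing R] [IsLocalRing R]

/-- **Branch descent of `p`-th powers (the missing (B5″) plumbing brick).**  `R` a local G-ring of characteristic `p` (e.g. `𝒪_{X,c}` on an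
excellent scheme), `𝔓` a prime of the completion `R^` which is a minimal prime over `𝔮 R^`, `𝔮 = 𝔓 ∩ R` (for the formal axis of a
straightened births chain: `dim R/𝔮 = 1`, `𝔓 ≠ 𝔪̂`), `t, w ∈ R` and `ĝ ∈ R^` with `t + w ĝ^p ∈ 𝔓`.  Then there are `a, b ∈ R` with
`b ∉ 𝔮` and `t b^p + w a^p ∈ 𝔮`: the class `−t/w` is a `p`-th power in `κ(𝔮)`, i.e. the formal leaf `t + w ĝ^p` through the formal
branch `𝔓` has an ALGEBRAIC representative `t b^p + w a^p` through the algebraic branch `𝔮` below it.  (`κ(𝔓) = (R^)_𝔓 / 𝔮 (R^)_𝔓`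
is a localization of the geometrically regular formal fibre `κ(𝔮) ⊗_R R^`; §1–§3.) [cite: Matsumura1987, §32 p. 256] -/
theorem exists_add_mul_pow_mem_under_of_mem_minimalPrimes (hG : IsGRing R) (p : ℕ) [Fact p.Prime] [CharP R p]
    (𝔓 : Ideal (AdicCompletion (maximalIdeal R) R)) [𝔓.IsPrime] (hmin : 𝔓 ∈ ((𝔓.under R).map (algebraMap R (AdicCompletion (maximalIdeal R) R))).minimalPrimes)
    {t w : R} {ĝ : (AdicCompletion (maximalIdeal R) R)} (h : algebraMap R (AdicCompletion (maximalIdeal R) R) t + algebraMap R (AdicCompletion (maximalIdeal R) R) w * ĝ ^ p ∈ 𝔓) :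
    ∃ a b : R, b ∉ 𝔓.under R ∧ t * b ^ p + w * a ^ p ∈ 𝔓.under R := by
  let qq : PrimeSpectrum ((𝔓.under R).Fiber (AdicCompletion (maximalIdeal R) R)) :=
    PrimeSpectrum.primesOverOrderIsoFiber R (AdicCompletion (maximalIdeal R) R) (𝔓.under R) ⟨𝔓, inferInstance, inferInstance⟩
  have hq : qq.asIdeal.comap (Algebra.TensorProduct.includeRight : (AdicCompletion (maximalIdeal R) R) →ₐ[R] (𝔓.under R).Fiber (AdicCompletion (maximalIdeal R) R)) = 𝔓 := by
    have h1 := PrimeSpectrum.coe_primesOverOrderIsoFiber_symm_apply (R := R) (S := (AdicCompletion (maximalIdeal R) R)) (𝔓.under R) qq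
    rw [OrderIso.symm_apply_apply] at h1
    exact h1.symm
  have hmin' : qq.asIdeal.comap (Algebra.TensorProduct.includeRight : (AdicCompletion (maximalIdeal R) R) →ₐ[R] (𝔓.under R).Fiber (AdicCompletion (maximalIdeal R) R)) ∈
      ((𝔓.under R).map (algebraMap R (AdicCompletion (maximalIdeal R) R))).minimalPrimes := by
    rw [hq]; exact hmin
  have h' : algebraMap R (AdicCompletion (maximalIdeal R) R) t + algebraMap R (AdicCompletion (maximalIdeal R) R) w * ĝ ^ p ∈
      qq.asIdeal.comap (Algebra.TensorProduct.includeRight : (AdicCompletion (maximalIdeal R) R) →ₐ[R] (𝔓.under R).Fiber (AdicCompletion (maximalIdeal R) R)) := by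
    rw [hq]; exact h
  exact exists_add_mul_pow_mem_of_mem_comap_fiber hG p (𝔓.under R) qq.asIdeal hmin' h'

/-- The same in the currency of ✓ `births_axis_leaf` / localizations: `t + w g^p ∈ 𝔮 R_𝔮` for some `g ∈ R_𝔮`. [folklore] -/
theorem exists_add_mul_pow_mem_maximalIdeal_localization_of_mem_minimalPrimes (hG : IsGRing R) (p : ℕ) [Fact p.Prime]
    [CharP R p] (𝔓 : Ideal (AdicCompletion (maximalIdeal R) R)) [𝔓.IsPrime] (hmin : 𝔓 ∈ ((𝔓.under R).map (algebraMap R (AdicCompletion (maximalIdeal R) R))).minimalPrimes)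
    {t w : R} {ĝ : (AdicCompletion (maximalIdeal R) R)} (h : algebraMap R (AdicCompletion (maximalIdeal R) R) t + algebraMap R (AdicCompletion (maximalIdeal R) R) w * ĝ ^ p ∈ 𝔓) :
    ∃ g : Localization.AtPrime (𝔓.under R),
      algebraMap R (Localization.AtPrime (𝔓.under R)) t + algebraMap R (Localization.AtPrime (𝔓.under R)) w * g ^ p ∈
        maximalIdeal (Localization.AtPrime (𝔓.under R)) := by
  obtain ⟨a, b, hb, hab⟩ := exists_add_mul_pow_mem_under_of_mem_minimalPrimes hG p 𝔓 hmin h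
  set A := Localization.AtPrime (𝔓.under R)
  have hbu : IsUnit (algebraMap R A b) := IsLocalization.map_units A (⟨b, hb⟩ : (𝔓.under R).primeCompl)
  refine ⟨algebraMap R A a * (hbu.unit⁻¹ : Aˣ), ?_⟩
  -- `t + w (a/b)^p = b^{-p} (t b^p + w a^p)`
  have hmem : algebraMap R A (t * b ^ p + w * a ^ p) ∈ maximalIdeal A := by
    rw [← Localization.AtPrime.map_eq_maximalIdeal]
    exact Ideal.mem_map_of_mem _ hab
  have hbinv : algebraMap R A b * ((hbu.unit⁻¹ : Aˣ) : A) = 1 := hbu.mul_val_inv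
  have heq : algebraMap R A t + algebraMap R A w * (algebraMap R A a * ((hbu.unit⁻¹ : Aˣ) : A)) ^ p =
      ((hbu.unit⁻¹ : Aˣ) : A) ^ p * algebraMap R A (t * b ^ p + w * a ^ p) := by
    rw [map_add, map_mul, map_mul, map_pow, map_pow]
    have h1 : ((hbu.unit⁻¹ : Aˣ) : A) ^ p * (algebraMap R A b) ^ p = 1 := by
      rw [← mul_pow, mul_comm, hbinv, one_pow]
    linear_combination (-(algebraMap R A t)) * h1
  rw [heq]
  exact Ideal.mul_mem_left _ _ hmem

end Brick


end Summit.ResolutionOfSingularities.ResolutionOfSingularities.Theorems.RadicialJung.CleanModels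

end
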